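/-
Copyright (c) 2026 the pub-hodgecm-mathlib formalisation cell (harness21).  Prover seat hodgecm-mathlib-F0P3a-p07 (g11): road «S3-tree» (LEAD F0P3a-plan (g11), architect
A-p16 (g29) ruling A-81 (1) «SPAN-0-ram»: (a) «htr₂-ram»), brick htr₂-ram, FILE 1 of 2 «THE TYPE-TWO GRAM LEMMAS WITHOUT A DATUM»; 2026-09-01.
The proofs of §1–§3 are ADAPTED VERBATIM from ★ B-p14 (g35) `UnitaryLatticeTreeTypeTwoGram` §30–§32, with the datum `hd : UnramifiedLocalConjDatum σ ϖ` replaced by the four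
properties those proofs actually use (`σ` an involution, valuation-preserving, `ϖ` a uniformiser, a trace-one integral element) — so that the tamely RAMIFIED places (`σϖ = −ϖ`,
where no `UnramifiedLocalConjDatum` exists) are served by the same lemmas.
-/
import Literature.NumberTheory.Automorphic.UnitaryLatticeTreeTypeTwoGram   -- ★ T1d′ FILE 1 (B-p14 (g35)): `vertexTriple_of_latt_eq`, `formCongr_apply_eq_B₀`, `exists_v_apply_eq_one_of_v_det`, transvections ∕ permutation matrices, `latt_mul_eq_of_isIntMatrix`
import HarnessLib

/-!
# The lattice graph of a hermitian space — htr₂-ram FILE 1: THE GRAM MATRIX OF A TYPE-TWO VERTEX IN AN ADAPTED BASIS, DATUM-FREE (no hypothesis on `σϖ`)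
# (Jacobowitz 1962 §4, §7–§8; O'Meara §82F, §91C)

Topic `NumberTheory/Automorphic`; namespace `Literature.NumberTheory.Automorphic.UnitaryLatticeTree`.  THEOREMS ONLY (no definition, no instance, no notation, no named fact,
no `sorry`); kernel lane.  Cell `pub/hodgecm-mathlib` (D-0151), crux H413 = `stmt-HodgeConjecture-24833`; road «S3-tree», brick **htr₂-ram** (architect A-81 (1)(a)) = the type-two
transitivity «every type-two vertex of `(K³, J₀)` is `u·N₁`, `u ∈ U(σ, J₀)`» at a TAMELY RAMIFIED place, the twin of ★ B-p14 T1d′ (`…TypeTwoGram` ∕ `…TypeTwoHyperbolic` ∕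
`…TypeTwoTransitive`, which carry `hd : UnramifiedLocalConjDatum σ ϖ`, in particular `σϖ = ϖ`).
THE MATHEMATICS.  ★ B-p14's FILE 1 (§30–§32: a basis vector of unit length; an orthogonal basis `x ⊥ c₁, c₂`; the type-two block `G₁ ∈ ϖ·M₂(𝒪)`, `|det G₁| = |ϖ|²`) uses the
datum ONLY through «`σ` is an involution», «`σ` preserves `v`», «`ϖ` is a uniformiser» and «there is an integral `t` with `t + σt = 1`» — never through `σϖ = ϖ`.  This file
restates those three lemmas with exactly these four hypotheses (`exists_basis_v_B₀_eq_one_of_trace`, `exists_orthogonal_basis_of_trace`, `typeTwo_block_of_involution`; proofs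
adapted verbatim, credited), so that FILE 2 (`UnitaryLatticeTreeTypeTwoTransitiveRamified`) can run the ramified argument (`t = 1∕2` at a tamely ramified place).  ★ B-p14's
originals are the special case `hd.σσ, hd.vσ, hd.vϖ, hd.trace`.
HONEST LABEL: HC_CM is proved only modulo the 2 remaining named inputs (hLiu418 24832, h413 24833) until rung 0 closes; nothing printed is asserted here (elementary lattice
algebra over a valuation ring with involution); S3 (`stub_N6nsS3id`) stays a print row until the road's END lands.

* §1 **`exists_basis_v_B₀_eq_one_of_trace`**.  §2 **`exists_orthogonal_basis_of_trace`**.  §3 **`typeTwo_block_of_involution`**.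

## References
* [Jacobowitz1962] R. Jacobowitz, *Hermitian forms over local fields*, Amer. J. Math. 84 (1962), §4 (Jordan splittings), §7–§8 (unramified ∕ ramified).
* [Omeara1963] O. T. O'Meara, *Introduction to Quadratic Forms* (1963), §82F, §91C (Jordan splittings).
* [BruhatTits1972] F. Bruhat, J. Tits, *Groupes réductifs sur un corps local I*, Publ. Math. IHÉS 41 (1972), §10.
-/

set_option autoImplicit false

noncomputable section

open scoped Valued WithZero Matrix MatrixGroups

namespace Literature.NumberTheory.Automorphic.UnitaryLatticeTree

open Literature.NumberTheory.Automorphic Literature.NumberTheory.Automorphic.HermitianLattice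
open Literature.NumberTheory.Automorphic.CartanUnique

variable {K : Type*} [Field K] [Valued K ℤᵐ⁰] {σ : K →+* K} {ϖ : K}

/-! ## §1 A basis vector of unit length -/


/-- **A basis of a type-two vertex whose first vector has unit length.**  For a type-two vertex lattice `M` of `(K³, J₀)` (`σ` an involution preserving `v`, a trace-one integral element `t + σt = 1`; NO hypothesis on `σϖ` — the datum-free form of ★ B-p14's lemma, serving ramified places too) there is a basis `g` of `M` with
`|h(g e₀, g e₀)| = 1`: a unit Gram entry exists (`exists_v_apply_eq_one_of_v_det`); if it is diagonal, permute; if only `h(gᵢ, gⱼ)`, `i ≠ j`, is a unit, the vector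
`gᵢ + (t ∕ h(gᵢ,gⱼ))·gⱼ` (`t + σt = 1`) has length `≡ 1 (mod 𝔪)`. [cite: Jacobowitz1962, §4, §7] [cite: Omeara1963, §82F] -/
theorem exists_basis_v_B₀_eq_one_of_trace (hσ : ∀ x, σ (σ x) = x) (hvσ : ∀ a, Valued.v (σ a) = Valued.v a) (hϖ : Valued.v ϖ = WithZero.exp (-1 : ℤ))
    (htrace : ∃ t : K, Valued.v t ≤ 1 ∧ t + σ t = 1) {M : Submodule 𝒪[K] (Fin 3 → K)} (hM : IsVertexLattice σ ϖ ((StdForm.antidiagonal 3).over K) 2 M) :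
    ∃ g : GL (Fin 3) K, M = latt (g : Matrix (Fin 3) (Fin 3) K) ∧
      Valued.v (B₀ σ 3 ((g : Matrix (Fin 3) (Fin 3) K).mulVec (Pi.single 0 1)) ((g : Matrix (Fin 3) (Fin 3) K).mulVec (Pi.single 0 1))) = 1 := by
  obtain ⟨g, rfl, hint, -, hdet⟩ := id hM
  -- a swap moving index `k` to `0`
  have hswap : ∀ k : Fin 3, ∃ P : GL (Fin 3) K, IsIntMatrix (P : Matrix (Fin 3) (Fin 3) K) ∧ IsIntMatrix ((P⁻¹ : GL (Fin 3) K) : Matrix (Fin 3) (Fin 3) K) ∧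
      (P : Matrix (Fin 3) (Fin 3) K).mulVec (Pi.single 0 1) = Pi.single k 1 := by
    intro k
    have hPP : (Equiv.swap (0 : Fin 3) k).permMatrix K * (Equiv.swap (0 : Fin 3) k).permMatrix K = 1 := by
      rw [← Matrix.permMatrix_mul, Equiv.swap_mul_self, Matrix.permMatrix_one]
    refine ⟨⟨_, _, hPP, hPP⟩, isIntMatrix_permMatrix _, isIntMatrix_permMatrix _, ?_⟩
    change ((Equiv.swap (0 : Fin 3) k).permMatrix K).mulVec (Pi.single 0 1) = Pi.single k 1
    rw [permMatrix_swap_mulVec_single, Equiv.swap_apply_left]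
  have hG : ∀ a b, formCongr σ g ((StdForm.antidiagonal 3).over K) a b =
      B₀ σ 3 ((g : Matrix (Fin 3) (Fin 3) K).mulVec (Pi.single a 1)) ((g : Matrix (Fin 3) (Fin 3) K).mulVec (Pi.single b 1)) := formCongr_apply_eq_B₀ g
  by_cases hdiag : ∃ k, Valued.v (formCongr σ g ((StdForm.antidiagonal 3).over K) k k) = 1
  · obtain ⟨k, hk⟩ := hdiag
    obtain ⟨P, hP, hP', hPk⟩ := hswap k
    refine ⟨g * P, (latt_mul_eq_of_isIntMatrix g P hP hP').symm, ?_⟩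
    rw [Units.val_mul, ← Matrix.mulVec_mulVec, hPk, ← hG]; exact hk
  · push Not at hdiag
    obtain ⟨i, j, hij⟩ := exists_v_apply_eq_one_of_v_det hϖ hint hdet
    have hne : j ≠ i := fun h => hdiag i (by rw [← hij, h])
    obtain ⟨t, ht1, htt⟩ := htrace
    set β : K := formCongr σ g ((StdForm.antidiagonal 3).over K) i j with hβ
    have hβ0 : β ≠ 0 := fun h => by rw [h, map_zero] at hij; exact zero_ne_one hij
    set c : K := t / β with hc
    have hvc : Valued.v c ≤ 1 := by rw [hc, map_div₀, hij, div_one]; exact ht1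
    -- the transvection `E`: column `i` ↦ column `i` + `c`·column `j`
    have hdetT : (Matrix.transvection j i c : Matrix (Fin 3) (Fin 3) K).det ≠ 0 := by rw [Matrix.det_transvection_of_ne j i hne c]; exact one_ne_zero
    set E : GL (Fin 3) K := Matrix.GeneralLinearGroup.mkOfDetNeZero _ hdetT with hE
    have hEval : (E : Matrix (Fin 3) (Fin 3) K) = Matrix.transvection j i c := rfl
    have hEinv : ((E⁻¹ : GL (Fin 3) K) : Matrix (Fin 3) (Fin 3) K) = Matrix.transvection j i (-c) := by
      rw [Matrix.coe_units_inv, hEval]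
      exact Matrix.inv_eq_left_inv (by rw [Matrix.transvection_mul_transvection_same j i hne, neg_add_cancel, Matrix.transvection_zero])
    have hEint : IsIntMatrix (E : Matrix (Fin 3) (Fin 3) K) := by rw [hEval]; exact isIntMatrix_transvection hvc
    have hEint' : IsIntMatrix ((E⁻¹ : GL (Fin 3) K) : Matrix (Fin 3) (Fin 3) K) := by rw [hEinv]; exact isIntMatrix_transvection (by rw [Valuation.map_neg]; exact hvc)
    -- the new `i`-th basis vector `x = gᵢ + c·gⱼ` has unit length
    set x : Fin 3 → K := (g : Matrix (Fin 3) (Fin 3) K).mulVec (Pi.single i 1) + c • (g : Matrix (Fin 3) (Fin 3) K).mulVec (Pi.single j 1) with hx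
    have hcol : ((g * E : GL (Fin 3) K) : Matrix (Fin 3) (Fin 3) K).mulVec (Pi.single i 1) = x := by
      rw [Units.val_mul, ← Matrix.mulVec_mulVec, hEval, transvection_mulVec_single, if_pos rfl, Matrix.mulVec_add, Matrix.mulVec_smul]
    have hherm : formCongr σ g ((StdForm.antidiagonal 3).over K) j i = σ β := by
      rw [hβ, hG, hG]; exact (isHermitianForm_B₀ hσ _ _).symm
    have hBxx : B₀ σ 3 x x = 1 + (formCongr σ g ((StdForm.antidiagonal 3).over K) i i + σ c * c * formCongr σ g ((StdForm.antidiagonal 3).over K) j j) := by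
      have hcβ : c * β = t := div_mul_cancel₀ t hβ0
      have h1 : B₀ σ 3 x x = formCongr σ g ((StdForm.antidiagonal 3).over K) i i + c * β + σ c * σ β +
          σ c * (c * formCongr σ g ((StdForm.antidiagonal 3).over K) j j) := by
        simp only [hx, map_add, LinearMap.add_apply, form_smul_left, form_smul_right, ← hG, hherm, ← hβ]; ring
      rw [h1, ← map_mul, hcβ, ← htt]; ring
    have hvBxx : Valued.v (B₀ σ 3 x x) = 1 := by
      rw [hBxx]
      refine Valuation.map_one_add_of_lt _ (Valuation.map_add_lt _ (lt_of_le_of_ne (hint i i) (hdiag i)) ?_)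
      rw [map_mul, map_mul, hvσ]
      calc Valued.v c * Valued.v c * Valued.v (formCongr σ g ((StdForm.antidiagonal 3).over K) j j)
          ≤ 1 * 1 * Valued.v (formCongr σ g ((StdForm.antidiagonal 3).over K) j j) := mul_le_mul' (mul_le_mul' hvc hvc) le_rfl
        _ < 1 := by rw [one_mul, one_mul]; exact lt_of_le_of_ne (hint j j) (hdiag j)
    obtain ⟨P, hP, hP', hPi⟩ := hswap i
    refine ⟨g * E * P, ?_, ?_⟩
    · rw [latt_mul_eq_of_isIntMatrix _ P hP hP', latt_mul_eq_of_isIntMatrix g E hEint hEint']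
    · rw [Units.val_mul, ← Matrix.mulVec_mulVec, hPi, hcol]; exact hvBxx

/-! ## §2 An orthogonal basis adapted to the unit vector -/

/-- **JORDAN SPLITTING, matrix form**: a type-two vertex lattice `M` of `(K³, J₀)` (`σ` an involution preserving `v`, a trace-one integral element `t + σt = 1`; NO hypothesis on `σϖ` — the datum-free form of ★ B-p14's lemma, serving ramified places too) has a basis `g` with `|h(g e₀, g e₀)| = 1` and `h(g e₀, g e₁) = h(g e₀, g e₂) = 0`
(two transvections `e_j ↦ e_j − (h(x, g e_j) ∕ h(x,x))·e₀` applied to the basis of `exists_basis_v_B₀_eq_one`): `M = 𝒪x ⊥ N′`. [cite: Jacobowitz1962, §4] [cite: Omeara1963, §91C] -/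
theorem exists_orthogonal_basis_of_trace (hσ : ∀ x, σ (σ x) = x) (hvσ : ∀ a, Valued.v (σ a) = Valued.v a) (hϖ : Valued.v ϖ = WithZero.exp (-1 : ℤ))
    (htrace : ∃ t : K, Valued.v t ≤ 1 ∧ t + σ t = 1) {M : Submodule 𝒪[K] (Fin 3 → K)} (hM : IsVertexLattice σ ϖ ((StdForm.antidiagonal 3).over K) 2 M) :
    ∃ g : GL (Fin 3) K, M = latt (g : Matrix (Fin 3) (Fin 3) K) ∧
      Valued.v (B₀ σ 3 ((g : Matrix (Fin 3) (Fin 3) K).mulVec (Pi.single 0 1)) ((g : Matrix (Fin 3) (Fin 3) K).mulVec (Pi.single 0 1))) = 1 ∧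
      B₀ σ 3 ((g : Matrix (Fin 3) (Fin 3) K).mulVec (Pi.single 0 1)) ((g : Matrix (Fin 3) (Fin 3) K).mulVec (Pi.single 1 1)) = 0 ∧
      B₀ σ 3 ((g : Matrix (Fin 3) (Fin 3) K).mulVec (Pi.single 0 1)) ((g : Matrix (Fin 3) (Fin 3) K).mulVec (Pi.single 2 1)) = 0 := by
  obtain ⟨g, rfl, hx⟩ := exists_basis_v_B₀_eq_one_of_trace hσ hvσ hϖ htrace hM
  obtain ⟨hint, -, -⟩ := vertexTriple_of_latt_eq hvσ hM
  have hG : ∀ a b, formCongr σ g ((StdForm.antidiagonal 3).over K) a b =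
      B₀ σ 3 ((g : Matrix (Fin 3) (Fin 3) K).mulVec (Pi.single a 1)) ((g : Matrix (Fin 3) (Fin 3) K).mulVec (Pi.single b 1)) := formCongr_apply_eq_B₀ g
  set x : Fin 3 → K := (g : Matrix (Fin 3) (Fin 3) K).mulVec (Pi.single 0 1) with hxdef
  set ε : K := B₀ σ 3 x x with hε
  have hε0 : ε ≠ 0 := fun h => by rw [h, map_zero] at hx; exact zero_ne_one hx
  -- the two transvection coefficients
  have hcoef : ∀ k : Fin 3, Valued.v (-(B₀ σ 3 x ((g : Matrix (Fin 3) (Fin 3) K).mulVec (Pi.single k 1))) / ε) ≤ 1 := fun k => by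
    rw [map_div₀, Valuation.map_neg, hx, div_one, hxdef, ← hG]; exact hint 0 k
  have hT : ∀ k : Fin 3, k ≠ 0 → ∀ a : K, Valued.v a ≤ 1 → ∃ T : GL (Fin 3) K, IsIntMatrix (T : Matrix (Fin 3) (Fin 3) K) ∧
      IsIntMatrix ((T⁻¹ : GL (Fin 3) K) : Matrix (Fin 3) (Fin 3) K) ∧ (T : Matrix (Fin 3) (Fin 3) K) = Matrix.transvection 0 k a := by
    intro k hk a ha
    have hdetT : (Matrix.transvection 0 k a : Matrix (Fin 3) (Fin 3) K).det ≠ 0 := by rw [Matrix.det_transvection_of_ne 0 k hk.symm a]; exact one_ne_zero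
    refine ⟨Matrix.GeneralLinearGroup.mkOfDetNeZero _ hdetT, isIntMatrix_transvection ha, ?_, rfl⟩
    rw [Matrix.coe_units_inv, show ((Matrix.GeneralLinearGroup.mkOfDetNeZero _ hdetT : GL (Fin 3) K) : Matrix (Fin 3) (Fin 3) K) = Matrix.transvection 0 k a from rfl,
      Matrix.inv_eq_left_inv (by rw [Matrix.transvection_mul_transvection_same 0 k hk.symm, neg_add_cancel, Matrix.transvection_zero])]
    exact isIntMatrix_transvection (by rw [Valuation.map_neg]; exact ha)
  obtain ⟨T₁, hT₁, hT₁', hT₁v⟩ := hT 1 (by decide) _ (hcoef 1)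
  obtain ⟨T₂, hT₂, hT₂', hT₂v⟩ := hT 2 (by decide) _ (hcoef 2)
  refine ⟨g * T₁ * T₂, by rw [latt_mul_eq_of_isIntMatrix _ T₂ hT₂ hT₂', latt_mul_eq_of_isIntMatrix g T₁ hT₁ hT₁'], ?_, ?_, ?_⟩
  all_goals simp only [Units.val_mul, ← Matrix.mulVec_mulVec, hT₁v, hT₂v, transvection_mulVec_single, Fin.reduceEq, if_false, if_true, zero_smul, add_zero,
    Matrix.mulVec_add, Matrix.mulVec_smul, map_add, form_smul_right]
  · exact hx
  · rw [← hxdef, ← hε, div_mul_cancel₀ _ hε0, add_neg_cancel]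
  · rw [← hxdef, ← hε, div_mul_cancel₀ _ hε0, add_neg_cancel]

/-! ## §3 The `2 × 2` block of the Gram matrix in an orthogonal basis -/

/-- **THE TYPE-TWO BLOCK.**  In a basis `g` of a type-two vertex lattice of `(K³, J₀)` with `|h(g₀,g₀)| = 1` and `h(g₀,g₁) = h(g₀,g₂) = 0` (so `G = [ε] ⊕ G₁`): the block `G₁` has all
its entries in `ϖ𝒪` (they are `ε⁻¹ ×` entries of `adj G = det G · G⁻¹ ∈ ϖ·M₃(𝒪)`) and `|det G₁| = |h(g₁,g₁)h(g₂,g₂) − h(g₁,g₂)h(g₂,g₁)| = |ϖ|²` — `N′ = 𝒪g₁ + 𝒪g₂` is a `ϖ`-MODULAR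
plane. [cite: Jacobowitz1962, §4] [cite: Omeara1963, §91C] -/
theorem typeTwo_block_of_involution (hσ : ∀ x, σ (σ x) = x) (hvσ : ∀ a, Valued.v (σ a) = Valued.v a) (hϖ0 : ϖ ≠ 0) {g : GL (Fin 3) K} (hM : IsVertexLattice σ ϖ ((StdForm.antidiagonal 3).over K) 2 (latt (g : Matrix (Fin 3) (Fin 3) K)))
    (hx : Valued.v (B₀ σ 3 ((g : Matrix (Fin 3) (Fin 3) K).mulVec (Pi.single 0 1)) ((g : Matrix (Fin 3) (Fin 3) K).mulVec (Pi.single 0 1))) = 1)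
    (h01 : B₀ σ 3 ((g : Matrix (Fin 3) (Fin 3) K).mulVec (Pi.single 0 1)) ((g : Matrix (Fin 3) (Fin 3) K).mulVec (Pi.single 1 1)) = 0)
    (h02 : B₀ σ 3 ((g : Matrix (Fin 3) (Fin 3) K).mulVec (Pi.single 0 1)) ((g : Matrix (Fin 3) (Fin 3) K).mulVec (Pi.single 2 1)) = 0) :
    (∀ a b : Fin 3, a ≠ 0 → b ≠ 0 →
      Valued.v (B₀ σ 3 ((g : Matrix (Fin 3) (Fin 3) K).mulVec (Pi.single a 1)) ((g : Matrix (Fin 3) (Fin 3) K).mulVec (Pi.single b 1))) ≤ Valued.v ϖ) ∧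
    Valued.v (B₀ σ 3 ((g : Matrix (Fin 3) (Fin 3) K).mulVec (Pi.single 1 1)) ((g : Matrix (Fin 3) (Fin 3) K).mulVec (Pi.single 1 1)) *
        B₀ σ 3 ((g : Matrix (Fin 3) (Fin 3) K).mulVec (Pi.single 2 1)) ((g : Matrix (Fin 3) (Fin 3) K).mulVec (Pi.single 2 1)) -
      B₀ σ 3 ((g : Matrix (Fin 3) (Fin 3) K).mulVec (Pi.single 1 1)) ((g : Matrix (Fin 3) (Fin 3) K).mulVec (Pi.single 2 1)) *
        B₀ σ 3 ((g : Matrix (Fin 3) (Fin 3) K).mulVec (Pi.single 2 1)) ((g : Matrix (Fin 3) (Fin 3) K).mulVec (Pi.single 1 1))) = Valued.v ϖ ^ 2 := by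
  obtain ⟨hint, hinv, hdet⟩ := vertexTriple_of_latt_eq hvσ hM
  set G := formCongr σ g ((StdForm.antidiagonal 3).over K) with hGdef
  have hG : ∀ a b, G a b = B₀ σ 3 ((g : Matrix (Fin 3) (Fin 3) K).mulVec (Pi.single a 1)) ((g : Matrix (Fin 3) (Fin 3) K).mulVec (Pi.single b 1)) := formCongr_apply_eq_B₀ g
  have hherm : ∀ a b, G b a = σ (G a b) := fun a b => by rw [hG, hG]; exact (isHermitianForm_B₀ hσ _ _).symm
  have hG01 : G 0 1 = 0 := by rw [hG]; exact h01
  have hG02 : G 0 2 = 0 := by rw [hG]; exact h02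
  have hG10 : G 1 0 = 0 := by rw [hherm, hG01, map_zero]
  have hG20 : G 2 0 = 0 := by rw [hherm, hG02, map_zero]
  have hε : Valued.v (G 0 0) = 1 := by rw [hG]; exact hx
  -- `det G = ε · det G₁`
  have hdetG : G.det = G 0 0 * (G 1 1 * G 2 2 - G 1 2 * G 2 1) := by rw [Matrix.det_fin_three, hG01, hG02, hG10, hG20]; ring
  have hblock : Valued.v (G 1 1 * G 2 2 - G 1 2 * G 2 1) = Valued.v ϖ ^ 2 := by
    have h := hdet; rwa [hdetG, map_mul, hε, one_mul] at h
  refine ⟨?_, by rw [← hG, ← hG, ← hG, ← hG]; exact hblock⟩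
  -- `adj G = det G · G⁻¹ ∈ ϖ M₃(𝒪)`
  have hGu : IsUnit G.det := by
    rw [isUnit_iff_ne_zero]; intro h; rw [h, map_zero] at hdet; exact pow_ne_zero 2 ((Valuation.ne_zero_iff _).2 hϖ0) hdet.symm
  have hadj : ∀ a b, Valued.v (G.adjugate a b) ≤ Valued.v ϖ := by
    intro a b
    have hadjeq : G.adjugate = (G.det * ϖ⁻¹) • (ϖ • G⁻¹) := by
      rw [smul_smul, mul_assoc, inv_mul_cancel₀ hϖ0, mul_one, Matrix.inv_def, smul_smul, Ring.inverse_eq_inv', mul_inv_cancel₀ hGu.ne_zero, one_smul]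
    have hvϖ0 : Valued.v ϖ ≠ 0 := (Valuation.ne_zero_iff Valued.v).2 hϖ0
    rw [hadjeq, Matrix.smul_apply, smul_eq_mul, map_mul, map_mul, map_inv₀, hdet, pow_two, mul_assoc, mul_assoc, mul_inv_cancel_left₀ hvϖ0]
    exact mul_le_of_le_one_right' (hinv a b)
  -- the four entries of the block are `ε⁻¹ × (± adj G)`
  have e11 : G.adjugate 2 2 = G 0 0 * G 1 1 - G 0 1 * G 1 0 := by rw [Matrix.adjugate_fin_three]; rfl
  have e22 : G.adjugate 1 1 = G 0 0 * G 2 2 - G 0 2 * G 2 0 := by rw [Matrix.adjugate_fin_three]; rfl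
  have e12 : G.adjugate 1 2 = -(G 0 0 * G 1 2) + G 0 2 * G 1 0 := by rw [Matrix.adjugate_fin_three]; rfl
  have e21 : G.adjugate 2 1 = -(G 0 0 * G 2 1) + G 0 1 * G 2 0 := by rw [Matrix.adjugate_fin_three]; rfl
  have h11 : Valued.v (G 1 1) ≤ Valued.v ϖ := by
    have h := hadj 2 2; rwa [e11, hG01, zero_mul, sub_zero, map_mul, hε, one_mul] at h
  have h22 : Valued.v (G 2 2) ≤ Valued.v ϖ := by
    have h := hadj 1 1; rwa [e22, hG02, zero_mul, sub_zero, map_mul, hε, one_mul] at h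
  have h12 : Valued.v (G 1 2) ≤ Valued.v ϖ := by
    have h := hadj 1 2; rwa [e12, hG02, zero_mul, add_zero, Valuation.map_neg, map_mul, hε, one_mul] at h
  have h21 : Valued.v (G 2 1) ≤ Valued.v ϖ := by
    have h := hadj 2 1; rwa [e21, hG01, zero_mul, add_zero, Valuation.map_neg, map_mul, hε, one_mul] at h
  intro a b ha hb
  rw [← hG]
  fin_cases a
  · exact absurd rfl ha
  · fin_cases b
    · exact absurd rfl hb
    · exact h11
    · exact h12
  · fin_cases b
    · exact absurd rfl hb
    · exact h21
    · exact h22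


end Literature.NumberTheory.Automorphic.UnitaryLatticeTree

end
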